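/-
COR-CM (cell pub-hodgecm2, stage 2 of the Hodge ladder) — count-neutral KERNEL COMBINATORICS «the octic product column G = Q₈ × B, D₄ × B: orbit span,
value module and normal forms of translates» (seat prover-pub-hodgecm2-b23-g45-0, binder prover b23, gen 45; own census lane OCTIC-PRODUCT, claim HOME/INBOX.md
l.18829).  Bookkeeping definitions with bodies (`orbSpan`, `valMod`) + theorems — the group-dependent parts of gen 44ʼs `Census/QuarticInversion{Orbit,Generators}.lean`
for the motions `twH₄`, `twZ ζ` (CENTRAL `y`), `twT`; the label-level parts of those files (`memT/memS/memJ`, `Avec_mixFace`, `Avec_cross`, `ΦL`, `cB`, `kS/kY/kT/kTY`,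
`nf_S`, `nf_tS`) are used BY NAME; no `decide` beyond closed identities in `Bool`/`Fin 4`, no certificate, no named fact, no `sorry`.  `Interfaces.lean` (C1),
every E term, B01, `Transposition/*`, `PortJoin/*`, `D2Bridge/*` untouched.
HONEST FRAMING: `HC_CM` is NOT proved, here or anywhere in the tree; nothing here is a period, a count of record or a headline.
T5: n/a-class (no hypothesis binders beyond `Odd |B|`, `3 ≤ |B|`, slot data); checker: self, 2026-08-24.
-/
import Summits.HodgeConjecture.CorCM.Census.QuarticInversionGenerators
import Summits.HodgeConjecture.CorCM.Census.OcticProductEquivariance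

/-!
# The octic product column: the orbit span under `⟨H₀, y, t⟩` with `y` central, its value module, and the normal forms of translates

For a family `F` of exponent vectors on `(Ty B)⁴` let `orbSpan F` be the least submodule containing `F` and stable under the three motions `translH₄ g`,
`translZ ζ` (the CENTRAL `y` of `Census/OcticProductModel.lean`), `translT` — the `ℤ[G'_ζ(B)]`-module generated by `F` read in the model — and
`valMod F = Avec (orbSpan F)` its image under gen 44ʼs value vector.  As in gen 44ʼs `Census/QuarticInversionOrbit.lean`:
* §1 `orbSpan`, `valMod`, induction, `orbSpan F ≤ hodge₄` for `F ⊆ hodge₄`;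
* §2 **moving slot binomials inside the value module**: every slot (`slot_mem`), by the central `y` (`Z_mem`/`Z_mem'`: coordinate `σY j`, patterns by
  `qY ζ`, complemented-and-swapped on the mask `bY ζ` — the SAME pattern bookkeeping as gen 44ʼs `Y_mem`/`Y_mem'`, via `Census/OcticProductEquivariance`),
  by `t` (`T_mem`/`T_mem'`, gen 44ʼs statements over the new orbit span);
* §3 the two sources of binomials (`mix_mem`, `cross_mem`) over the new value module;
* §4 **normal forms of translates**: `nf_mem_of_bin`, `kOf_translZ`, `nf_translZ`, and for the equator squares `S_b` of the closing family
  **`nf (y·S_b) = ΦL (kY ζ, cB b ∘ pY ζ)`** (`nf_zS`) and **`nf (t·y·S_b) = ΦL (kTY ζ, cB b ∘ pY ζ ∘ pT)`** (`nf_tzS`) — LITERALLY gen 44ʼs right-hand sides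
  (`nf_yS`, `nf_tyS`): the normal form forgets the reversal of `B`, so gen 44ʼs lattice tables (`Census/QuarticInversionLattice.lean`) serve this column unchanged.
All [folklore] (bookkeeping in Pohlmannʼs model [Pohlmann1968, Thm 1]).

## References
* [Pohlmann1968] H. Pohlmann, Algebraic cycles on abelian varieties of complex multiplication type, Ann. of Math. 88 (1968), Thm 1.
-/

namespace Summit.HodgeConjecture.CorCM.Census.OcticProduct

open Finset
open Summit.HodgeConjecture.CorCM.Census.OddSliceFacesModel
open Summit.HodgeConjecture.CorCM.Census.QuarticInversion

noncomputable section

variable (A : Type) [AddCommGroup A] [Fintype A] [DecidableEq A] (ζ : ZMod 2)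

/-! ## §1 The orbit span and the value module -/

/-- **The orbit span of `F`** under `H₀`, the central `y` and `t`: the least submodule containing `F` and stable under `translH₄ g`, `translZ ζ`, `translT`.
[folklore] -/
def orbSpan (F : Set (Ty₄ A → ℤ)) : Submodule ℤ (Ty₄ A → ℤ) :=
  sInf {N | F ⊆ N ∧ (∀ g : ZMod 2 × A, ∀ v ∈ N, translH₄ A g v ∈ N) ∧ (∀ v ∈ N, translZ A ζ v ∈ N) ∧ (∀ v ∈ N, translT A v ∈ N)}

omit [Fintype A] [DecidableEq A] in
/-- `F ⊆ orbSpan F`. [folklore] -/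
theorem subset_orbSpan (F : Set (Ty₄ A → ℤ)) {f : Ty₄ A → ℤ} (hf : f ∈ F) : f ∈ orbSpan A ζ F := by
  rw [orbSpan, Submodule.mem_sInf]
  intro N hN
  exact hN.1 hf

omit [Fintype A] [DecidableEq A] in
/-- The orbit span is stable under `H₀`. [folklore] -/
theorem translH₄_mem_orbSpan (F : Set (Ty₄ A → ℤ)) (g : ZMod 2 × A) {v : Ty₄ A → ℤ} (hv : v ∈ orbSpan A ζ F) :
    translH₄ A g v ∈ orbSpan A ζ F := by
  rw [orbSpan, Submodule.mem_sInf] at hv ⊢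
  intro N hN
  exact hN.2.1 g v (hv N hN)

omit [Fintype A] [DecidableEq A] in
/-- The orbit span is stable under the central `y`. [folklore] -/
theorem translZ_mem_orbSpan (F : Set (Ty₄ A → ℤ)) {v : Ty₄ A → ℤ} (hv : v ∈ orbSpan A ζ F) : translZ A ζ v ∈ orbSpan A ζ F := by
  rw [orbSpan, Submodule.mem_sInf] at hv ⊢
  intro N hN
  exact hN.2.2.1 v (hv N hN)

omit [Fintype A] [DecidableEq A] in
/-- The orbit span is stable under `t`. [folklore] -/
theorem translT_mem_orbSpan (F : Set (Ty₄ A → ℤ)) {v : Ty₄ A → ℤ} (hv : v ∈ orbSpan A ζ F) : translT A v ∈ orbSpan A ζ F := by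
  rw [orbSpan, Submodule.mem_sInf] at hv ⊢
  intro N hN
  exact hN.2.2.2 v (hv N hN)

omit [Fintype A] [DecidableEq A] in
/-- **Induction**: a stable submodule containing `F` contains the orbit span. [folklore] -/
theorem orbSpan_le {F : Set (Ty₄ A → ℤ)} {N : Submodule ℤ (Ty₄ A → ℤ)} (hF : F ⊆ N) (hH : ∀ g : ZMod 2 × A, ∀ v ∈ N, translH₄ A g v ∈ N)
    (hZ : ∀ v ∈ N, translZ A ζ v ∈ N) (hT : ∀ v ∈ N, translT A v ∈ N) : orbSpan A ζ F ≤ N :=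
  sInf_le ⟨hF, hH, hZ, hT⟩

/-- The orbit span of a family of Hodge vectors lies in `hodge₄`. [folklore] -/
theorem orbSpan_le_hodge₄ {F : Set (Ty₄ A → ℤ)} (hF : F ⊆ hodge₄ A) : orbSpan A ζ F ≤ hodge₄ A :=
  orbSpan_le A ζ hF (fun g _ hv => translH₄_mem A hv g) (fun _ hv => translZ_mem A ζ hv) (fun _ hv => translT_mem A hv)

/-- **The value module** of `F`: the value vectors of the orbit span. [folklore] -/
def valMod (F : Set (Ty₄ A → ℤ)) : Submodule ℤ (Idx A → ℤ) := (orbSpan A ζ F).map (Avec A)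

/-- Value vectors of members of the orbit span lie in the value module. [folklore] -/
theorem Avec_mem_valMod (F : Set (Ty₄ A → ℤ)) {v : Ty₄ A → ℤ} (hv : v ∈ orbSpan A ζ F) : Avec A v ∈ valMod A ζ F :=
  Submodule.mem_map_of_mem hv

/-! ## §2 Moving binomials inside the value module -/

variable {ζ}

/-- **Every slot**: a binomial in the value module is there at every slot. [folklore] -/
theorem slot_mem (hA : Odd (Fintype.card A)) {F : Set (Ty₄ A → ℤ)} {j : Fin 4} {h h' : Fin 4 → Bool} {u : A}
    (H : binVec A j h h' u ∈ valMod A ζ F) (u' : A) : binVec A j h h' u' ∈ valMod A ζ F := by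
  obtain ⟨c, hc, e⟩ := Submodule.mem_map.mp H
  refine Submodule.mem_map.mpr ⟨translH₄ A (0, u - u') c, translH₄_mem_orbSpan A ζ F _ hc, ?_⟩
  rw [Avec_translH₄_of_binVec A hA (u - u') e, sub_sub_cancel]

/-- **Moved by the central `y`, off the mask.** [folklore] -/
theorem Z_mem (hA : Odd (Fintype.card A)) {F : Set (Ty₄ A → ℤ)} {j j' : Fin 4} {h h' g g' : Fin 4 → Bool} {u : A}
    (hb : bY ζ (σY j) = false) (ej : σY j = j') (e1 : qY ζ h = g) (e2 : qY ζ h' = g') (H : binVec A j h h' u ∈ valMod A ζ F) (u' : A) :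
    binVec A j' g g' u' ∈ valMod A ζ F := by
  obtain ⟨c, hc, e⟩ := Submodule.mem_map.mp H
  have hy : Avec A (translZ A ζ c) = binVec A j' g g' u := by
    rw [Avec_translZ_of_binVec A hA ζ e, hb]; simp only [Bool.false_eq_true, if_false, ej, e1, e2]
  exact slot_mem A hA (Submodule.mem_map.mpr ⟨translZ A ζ c, translZ_mem_orbSpan A ζ F hc, hy⟩) u'

/-- **Moved by the central `y`, on the mask** (patterns complemented and swapped). [folklore] -/
theorem Z_mem' (hA : Odd (Fintype.card A)) {F : Set (Ty₄ A → ℤ)} {j j' : Fin 4} {h h' g g' : Fin 4 → Bool} {u : A}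
    (hb : bY ζ (σY j) = true) (ej : σY j = j') (e1 : qY ζ (fun n => !h' n) = g) (e2 : qY ζ (fun n => !h n) = g')
    (H : binVec A j h h' u ∈ valMod A ζ F) (u' : A) : binVec A j' g g' u' ∈ valMod A ζ F := by
  obtain ⟨c, hc, e⟩ := Submodule.mem_map.mp H
  have hy : Avec A (translZ A ζ c) = binVec A j' g g' u := by
    rw [Avec_translZ_of_binVec A hA ζ e, hb]; simp only [if_true, ej, e1, e2]
  exact slot_mem A hA (Submodule.mem_map.mpr ⟨translZ A ζ c, translZ_mem_orbSpan A ζ F hc, hy⟩) u'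

/-- **Moved by `t`, off the mask.** [folklore] -/
theorem T_mem (hA : Odd (Fintype.card A)) {F : Set (Ty₄ A → ℤ)} {j j' : Fin 4} {h h' g g' : Fin 4 → Bool} {u : A}
    (hb : bT (σT j) = false) (ej : σT j = j') (e1 : qT h = g) (e2 : qT h' = g') (H : binVec A j h h' u ∈ valMod A ζ F) (u' : A) :
    binVec A j' g g' u' ∈ valMod A ζ F := by
  obtain ⟨c, hc, e⟩ := Submodule.mem_map.mp H
  have ht : Avec A (translT A c) = binVec A j' g g' u := by
    rw [Avec_translT_of_binVec A hA e, hb]; simp only [Bool.false_eq_true, if_false, ej, e1, e2]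
  exact slot_mem A hA (Submodule.mem_map.mpr ⟨translT A c, translT_mem_orbSpan A ζ F hc, ht⟩) u'

/-- **Moved by `t`, on the mask.** [folklore] -/
theorem T_mem' (hA : Odd (Fintype.card A)) {F : Set (Ty₄ A → ℤ)} {j j' : Fin 4} {h h' g g' : Fin 4 → Bool} {u : A}
    (hb : bT (σT j) = true) (ej : σT j = j') (e1 : qT (fun n => !h' n) = g) (e2 : qT (fun n => !h n) = g')
    (H : binVec A j h h' u ∈ valMod A ζ F) (u' : A) : binVec A j' g g' u' ∈ valMod A ζ F := by
  obtain ⟨c, hc, e⟩ := Submodule.mem_map.mp H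
  have ht : Avec A (translT A c) = binVec A j' g g' u := by
    rw [Avec_translT_of_binVec A hA e, hb]; simp only [if_true, ej, e1, e2]
  exact slot_mem A hA (Submodule.mem_map.mpr ⟨translT A c, translT_mem_orbSpan A ζ F hc, ht⟩) u'

/-! ## §3 The two sources of binomials -/

/-- **Mixed faces of the family give binomials at every slot** (patterns supplied as literals via `e1`, `e2`). [folklore] -/
theorem mix_mem (hA : Odd (Fintype.card A)) (h3 : 3 ≤ Fintype.card A) {F : Set (Ty₄ A → ℤ)} {Q : Finset A} {w : A} (hw : w ∉ Q)
    (hQ : Q.card = Fintype.card A / 2) {i : Fin 4} (hi : i ≠ 0) {u : A} {b : Fin 4 → Bool} (hb : b i = true)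
    (hF : mixFace A Q w i u b ∈ F) {g g' : Fin 4 → Bool} (e1 : (fun n => if n = 0 then false else !b n) = g)
    (e2 : (fun n => if n = 0 then true else !b n) = g') (u' : A) : binVec A i g g' u' ∈ valMod A ζ F := by
  have h := Avec_mem_valMod A ζ F (subset_orbSpan A ζ F hF)
  rw [Avec_mixFace A hA h3 hw hQ hi u hb, e1, e2] at h
  exact slot_mem A hA h u'

/-- **The antipodal binomials of coordinate `0` at every slot**, from a complementary pair `S_b, S_{!b}` of the family and a cross datum. [folklore] -/
theorem cross_mem (hA : Odd (Fintype.card A)) {F : Set (Ty₄ A → ℤ)} {P : Finset A} {u₁ u₂ : A} (h1 : u₁ ∉ P) (h2 : u₂ ∉ P)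
    (h12 : u₁ ≠ u₂) (hP : P.card + 1 = Fintype.card A / 2) {σ s₀ : A} (hs₀ : s₀ ∈ insert u₁ (insert u₂ P))
    (hX : ∀ s, s + σ ∈ insert u₁ (insert u₂ P) ↔ (s ∉ insert u₁ (insert u₂ P) ∨ s = s₀)) {b : Fin 4 → Bool}
    (hb : sqFace A P u₁ u₂ b ∈ F) (hb' : sqFace A P u₁ u₂ (fun n => !b n) ∈ F) {g : Fin 4 → Bool} (e1 : (fun n => !b n) = g)
    (u' : A) : binVec A 0 g b u' ∈ valMod A ζ F := by
  have hdiff : sqFace A P u₁ u₂ b - translH₄ A (0, σ) (sqFace A P u₁ u₂ (fun n => !b n)) ∈ orbSpan A ζ F :=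
    Submodule.sub_mem _ (subset_orbSpan A ζ F hb) (translH₄_mem_orbSpan A ζ F _ (subset_orbSpan A ζ F hb'))
  have h := Avec_mem_valMod A ζ F hdiff
  rw [map_sub, Avec_cross A hA h1 h2 h12 hP hs₀ hX, e1] at h
  exact slot_mem A hA h u'

/-! ## §4 Normal forms of translates -/

/-- **The normal form of a member of the orbit span lies in the value module** once every slot binomial does. [folklore] -/
theorem nf_mem_of_bin (hA : Odd (Fintype.card A)) {F : Set (Ty₄ A → ℤ)} (hF : F ⊆ hodge₄ A)
    (hbin : ∀ j h h' u, binVec A j h h' u ∈ valMod A ζ F) {v : Ty₄ A → ℤ} (hv : v ∈ orbSpan A ζ F) :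
    nf A v ∈ valMod A ζ F := by
  have hle : binSpan A ≤ valMod A ζ F := Submodule.span_le.mpr (by rintro _ ⟨j, h, h', u, rfl⟩; exact hbin j h h' u)
  have h1 := Avec_mem_valMod A ζ F hv
  have h2 := hle (Avec_sub_nf_mem A hA (orbSpan_le_hodge₄ A ζ hF hv))
  have := (valMod A ζ F).sub_mem h1 h2
  rwa [sub_sub_cancel] at this

/-- `kOf j (y·v) = ± kOf (σY j) v` for the central `y`. [folklore] -/
theorem kOf_translZ (hA : Odd (Fintype.card A)) (j : Fin 4) (v : Ty₄ A → ℤ) :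
    kOf A j (translZ A ζ v) = (if bY ζ j then -1 else 1) * kOf A (σY j) v := by
  unfold kOf; rw [fnl_wUp_translZ A hA]

/-- **The normal form of `y·v`** for the central `y` — gen 44ʼs right-hand side. [folklore] -/
theorem nf_translZ (hA : Odd (Fintype.card A)) (v : Ty₄ A → ℤ) :
    nf A (translZ A ζ v) = ΦL A (fun j => (if bY ζ j then -1 else 1) * kOf A (σY j) v, fun η => fnl A (wC A (pY ζ η)) v) := by
  rw [nf_eq_ΦL]
  congr 1
  ext j
  · exact kOf_translZ A hA j v
  · exact fnl_wC_translZ A hA ζ _ v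

section Family
variable {P : Finset A} {u₁ u₂ : A}

/-- **`nf (y·S_b) = ΦL (kY ζ, cB b ∘ pY ζ)`** for the central `y`. [folklore] -/
theorem nf_zS (hA : Odd (Fintype.card A)) (h1 : u₁ ∉ P) (h2 : u₂ ∉ P) (h12 : u₁ ≠ u₂)
    (hP : P.card + 1 = Fintype.card A / 2) (b : Fin 4 → Bool) :
    nf A (translZ A ζ (sqFace A P u₁ u₂ b)) = ΦL A (kY ζ, fun η => cB b (pY ζ η)) := by
  rw [nf_translZ A hA]
  congr 1
  ext j
  · show (if bY ζ j then -1 else 1) * kOf A (σY j) (sqFace A P u₁ u₂ b) = (if bY ζ j then -1 else 1) * kS (σY j)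
    rw [kOf_sqFace A hA h1 h2 h12 hP]; rfl
  · exact fnl_wC_sqFace_eq_cB A hA h1 h2 h12 hP b _

/-- **`nf (t·y·S_b) = ΦL (kTY ζ, cB b ∘ pY ζ ∘ pT)`** for the central `y`. [folklore] -/
theorem nf_tzS (hA : Odd (Fintype.card A)) (h1 : u₁ ∉ P) (h2 : u₂ ∉ P) (h12 : u₁ ≠ u₂)
    (hP : P.card + 1 = Fintype.card A / 2) (b : Fin 4 → Bool) :
    nf A (translT A (translZ A ζ (sqFace A P u₁ u₂ b))) = ΦL A (kTY ζ, fun η => cB b (pY ζ (pT η))) := by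
  rw [nf_translT A hA]
  congr 1
  ext j
  · show (if bT j then -1 else 1) * kOf A (σT j) (translZ A ζ (sqFace A P u₁ u₂ b)) = (if bT j then -1 else 1) * kY ζ (σT j)
    rw [kOf_translZ A hA, kOf_sqFace A hA h1 h2 h12 hP]; rfl
  · exact fnl_wC_translZ A hA ζ _ _ |>.trans (fnl_wC_sqFace_eq_cB A hA h1 h2 h12 hP b _)

end Family

end

end Summit.HodgeConjecture.CorCM.Census.OcticProduct
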